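import Summits.BirchSwinnertonDyer.BirchSwinnertonDyer.Theses.ShaPrimaryTransfer
import Literature.NumberTheory.EllipticCurves.KubertTate1314FiveIsogeny
import Literature.NumberTheory.EllipticCurves.KubertTate1314Rank
import Literature.NumberTheory.EllipticCurves.KubertTate1314RankLe
import Literature.NumberTheory.EllipticCurves.TwoIsogenyShaTwoTorsion
import HarnessLib

/-!
# Route ShaPrimaryTransfer — THE DOOR AT `5`: the `ℤ/5`-side of a `5`-descent on the rank-`2`
# Kubert–Tate curve `E_{13/14}`, and what `T = FiniteShaComponentTransfer` says there

Helper for item stmt-BirchSwinnertonDyer-22356 (`FiniteShaComponentTransfer`, «T»; conjecture-grade at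
rank `≥ 2`) of route `route-BirchSwinnertonDyer-ShaPrimaryTransfer`. BSD is NOT proved by any of this;
no beyond-print theorem is claimed.

Generations g0–g11 of this seat opened the door (T's hypothesis `t_p(E) = 0`, by descent) only at
`p = 2` and `p = 3`. This file records the first step at `p = 5` — the prime where the route's
items X2/X3 (`AnalyticRankLeSelmerCorank`, `PadicOrderLeAnalyticRankAtOnePrime`) and KatoTransfer's X1
live (`good ordinary p ≥ 5`) — on the Kubert–Tate curve

  `E = E_{13/14} = [1, -182, -2548, 0, 0] : y² + xy - 2548y = x³ - 182x²`

(`T₀ = (0,0)` of order `5`; `Δ = -2⁵·7⁵·13⁵·2029`; rank `2` numerically, points `(-78, 936)`,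
`(98, 392)`), proved in `Literature/NumberTheory/EllipticCurves/KubertTate1314FiveIsogeny.lean` by
Mazur's étale-kernel descent in the Kronecker–Weber-free régime (all bad primes `≢ 1 (mod 5)`,
`5 ∤ Δ`):

* `doorAtFive_selmer_phi` / `doorAtFive_sha_phi` — **`Sel^φ(E/ℚ) = 0` and `Ш(E/ℚ)[φ] = 0`** for the
  `5`-isogeny `φ : E → E/⟨T₀⟩` (the `ℤ/5`-side of the `5`-descent is empty);
* `five_not_dvd_Δ` — `5` is a prime of good reduction of the integer model;
* `shaCorank_five_eq_zero_of_sha_five` — the REMAINING half: `Ш(E/ℚ)[5] = 0` (equivalently, given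
  the above, the `μ₅`-side `Ш(E'/ℚ)[φ̂] = 0`) gives T's hypothesis `t_5(E) = 0` (tree
  `shaCorank_eq_zero_of_forall`);
* `transfer_at_five` — **T BY NAME then predicts `t_q(E) = 0` for every prime `q`** on this rank-`2`
  curve; `transfer_at_five_iff` — T's instances `(E, 5, q)` are exactly the statements `t_q(E) = 0`
  once `t_5(E) = 0`.

The `μ₅`-side (local Kummer conditions of `Sel^{(5)}(E) ↪ ℚˣ/ℚˣ⁵` at `v ∤ 182`, from
`KubertTateFiveKummerValuation` / `KubertTateFiveKummerDivisor` / `IsogenyDescentKummerElement`) is the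
successor's target `∀ c ∈ E.sha, 5 • c = 0 → c = 0`.
-/

set_option linter.dupNamespace false

namespace Summit.BirchSwinnertonDyer.BirchSwinnertonDyer.Theorems.ShaPrimaryTransferDoorAtFive

open Summit.BirchSwinnertonDyer.BirchSwinnertonDyer.Theses.ShaPrimaryTransfer
open Literature.NumberTheory.EllipticCurves Literature.NumberTheory.EllipticCurves.KubertTate1314

/-- **The door at `5`, `ℤ/5`-side: `Sel^φ(E_{13/14}/ℚ) = 0`** for the `5`-isogeny with kernel
`⟨(0,0)⟩` (re-export of `KubertTate1314.selmerGroup_fiveIsogeny_eq_bot`). -/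
theorem doorAtFive_selmer_phi : fiveIsogeny.selmerGroup = ⊥ :=
  selmerGroup_fiveIsogeny_eq_bot

/-- **The door at `5`, `ℤ/5`-side: `Ш(E_{13/14}/ℚ)[φ] = 0`** — the kernel of
`Ш(φ) : Ш(E/ℚ) → Ш(E'/ℚ)` is trivial (re-export of `KubertTate1314.ker_shaMap_fiveIsogeny_eq_bot`). -/
theorem doorAtFive_sha_phi :
    (shaMap fiveIsogeny.toAddMonoidHom fiveIsogeny.equivariant
      fiveIsogeny.hasLocalPointsMaps_toAddMonoidHom).ker = ⊥ :=
  ker_shaMap_fiveIsogeny_eq_bot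

/-- Elementwise form: a class of `Ш(E_{13/14}/ℚ)` killed by `Ш(φ)` is zero. -/
theorem eq_zero_of_shaMap_fiveIsogeny_eq_zero {c : curveE.sha}
    (hc : shaMap fiveIsogeny.toAddMonoidHom fiveIsogeny.equivariant
      fiveIsogeny.hasLocalPointsMaps_toAddMonoidHom c = 0) : c = 0 := by
  have hmem : c ∈ (shaMap fiveIsogeny.toAddMonoidHom fiveIsogeny.equivariant
      fiveIsogeny.hasLocalPointsMaps_toAddMonoidHom).ker := (AddMonoidHom.mem_ker).mpr hc
  rw [doorAtFive_sha_phi] at hmem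
  exact (AddSubgroup.mem_bot).mp hmem

/-- `E'(ℚ) = φ(E(ℚ))` on `E_{13/14}` (re-export): every rational point of
`E' = [1, -182, -2548, -306670, -121427670]` is the image of a rational point of `E`. -/
theorem doorAtFive_rationalPoints (P' : curveE'.toAffine.Point) :
    ∃ P : curveE.toAffine.Point, curveE'.toGeomPoints P' = fiveIsogeny (curveE.toGeomPoints P) :=
  exists_toGeomPoints_eq P'

/-- **`5` is a prime of good reduction of the integer model `[1, -182, -2548, 0, 0]`**:
`5 ∤ Δ = -405171591170528`. (With the rational `5`-torsion point this makes `5` good ORDINARY —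
`#E(𝔽₅) ∈ {5, 10}`, `a₅ ∈ {1, -4}` — the kind of prime at which X1/X2/X3 are stated.) -/
theorem five_not_dvd_Δ : ¬ (5 : ℤ) ∣ curveE₀.Δ := by
  rw [curveE₀_Δ]; norm_num

/-- **The remaining half of the door at `5`.** If `Ш(E_{13/14}/ℚ)` has no `5`-torsion (the `μ₅`-side
of the `5`-descent: `Ш(E'/ℚ)[φ̂] = 0`, equivalently `#Sel^{(5)}(E/ℚ) = 125`), then T's hypothesis holds
at `p = 5`: `corank_{ℤ₅} Ш(E/ℚ)[5^∞] = 0` (tree `shaCorank_eq_zero_of_forall`). -/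
theorem shaCorank_five_eq_zero_of_sha_five
    (h5 : ∀ c ∈ curveE.sha, (5 : ℕ) • c = 0 → c = 0) : curveE.shaCorank 5 = 0 := by
  haveI : Fact (Nat.Prime 5) := ⟨Nat.prime_five⟩
  exact curveE.shaCorank_eq_zero_of_forall 5 h5

/-- **`T` BY NAME on the door at `5`**: granting `FiniteShaComponentTransfer`, once `Ш(E_{13/14}/ℚ)[5] = 0`
is certified, `t_q(E_{13/14}) = 0` for EVERY prime `q` — on a curve of rank `2` where no theorem in
print gives the finiteness of any `Ш[q^∞]`. -/
theorem transfer_at_five (hT : FiniteShaComponentTransfer)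
    (h5 : ∀ c ∈ curveE.sha, (5 : ℕ) • c = 0 → c = 0) (q : ℕ) [Fact q.Prime] :
    curveE.shaCorank q = 0 := by
  haveI : Fact (Nat.Prime 5) := ⟨Nat.prime_five⟩
  exact hT curveE 5 q (shaCorank_five_eq_zero_of_sha_five h5)

/-- The instances `(E_{13/14}, 5, q)` of `T`, read as an equivalence: given the door at `5`
(`t_5(E) = 0`), T's instances at `p = 5` on this curve say exactly `t_q(E) = 0` for all `q`; and
conversely these statements are instances of T. -/
theorem transfer_at_five_iff (h5 : curveE.shaCorank 5 = 0) :
    (∀ q : ℕ, [Fact q.Prime] → curveE.shaCorank 5 = 0 → curveE.shaCorank q = 0) ↔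
      ∀ q : ℕ, [Fact q.Prime] → curveE.shaCorank q = 0 :=
  ⟨fun h q _ ↦ h q h5, fun h q _ _ ↦ h q⟩

/-- `O = OneFiniteShaComponent` holds for `E_{13/14}` as soon as its `Ш` has no `5`-torsion (witness
`p₀ = 5`: the first door at a prime `≥ 5` in this route's census). -/
theorem oneFiniteShaComponent_curveE_of_sha_five
    (h5 : ∀ c ∈ curveE.sha, (5 : ℕ) • c = 0 → c = 0) :
    ∃ (p : ℕ) (_ : Fact p.Prime), curveE.shaCorank p = 0 :=
  ⟨5, ⟨Nat.prime_five⟩, shaCorank_five_eq_zero_of_sha_five h5⟩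

/-! ### Appendix (g12, second landing): the carrier is CERTIFIED to lie in the rank `≥ 2` régime -/

/-- **`rank E_{13/14}(ℚ) ≥ 2`, unconditionally** (re-export of
`KubertTate1314Descent.two_le_mordellWeilRank`: the `μ₅`-side of the `5`-descent read on rational
points — Kummer elements, Weil-pairing bilinearity, and the `2`-, `7`-, `13`-adic valuations of
`f_T = xy - 14x² + 196y` at `2T`, `(-78, 936)`, `(98, 392)` — together with `E(ℚ)[5] = ⟨T⟩` and
`#E(ℚ)/5E(ℚ) = 5^{rank}·#E(ℚ)[5]`). So the instance `(E_{13/14}, 5, q)` of `T` is OUTSIDE every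
rank-`≤ 1` sector of the route's census (Kolyvagin / Gross–Zagier / the `p`-converse theorems): no
theorem in print gives the finiteness of any `Ш(E_{13/14}/ℚ)[q^∞]`. -/
theorem two_le_mordellWeilRank_curveE : 2 ≤ curveE.mordellWeilRank := by
  rw [curveE_eq_kubertTateFive]
  exact KubertTate1314Descent.two_le_mordellWeilRank

/-- **The door at `5`, status after g12**: on `E_{13/14}` the `ℤ/5`-side of the `5`-descent is
closed (`Sel^φ = 0`) AND the rank is `≥ 2`; what `T` needs in addition is `Ш(E/ℚ)[5] = 0`
(`shaCorank_five_eq_zero_of_sha_five`), after which `T` BY NAME gives `t_q(E) = 0` for all `q`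
(`transfer_at_five`) on a certified rank-`≥ 2` curve. -/
theorem doorAtFive_status :
    fiveIsogeny.selmerGroup = ⊥ ∧ 2 ≤ curveE.mordellWeilRank ∧
      (FiniteShaComponentTransfer → (∀ c ∈ curveE.sha, (5 : ℕ) • c = 0 → c = 0) →
        ∀ q : ℕ, [Fact q.Prime] → curveE.shaCorank q = 0) :=
  ⟨doorAtFive_selmer_phi, two_le_mordellWeilRank_curveE, fun hT h5 q _ ↦ transfer_at_five hT h5 q⟩

/-- **`rank E_{13/14}(ℚ) = 2` exactly, unconditionally** (re-export of
`KubertTate1314Descent.mordellWeilRank_eq_two`: the complete `μ₅`-side of the `5`-descent on rational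
points — `E(ℚ)/5E(ℚ) ≅ (ℤ/5)³` generated by `2T`, `(-78, 936)`, `(98, 392)` — with `E(ℚ)[5] = ⟨T⟩` and
`#E(ℚ)/5E(ℚ) = 5^{rank}·#E(ℚ)[5]`). Hence at the door `(E_{13/14}, 5)` the hypothesis `t_5(E) = 0` of `T`
is EXACTLY the statement `Ш(E/ℚ)[5] = 0` (`#Sel⁵(E/ℚ) = 125`), on a curve of certified rank `2`. -/
theorem mordellWeilRank_curveE_eq_two : curveE.mordellWeilRank = 2 := by
  rw [curveE_eq_kubertTateFive]
  exact KubertTate1314Descent.mordellWeilRank_eq_two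

end Summit.BirchSwinnertonDyer.BirchSwinnertonDyer.Theorems.ShaPrimaryTransferDoorAtFive
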